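import Literature.MathematicalPhysics.KineticTheory.HydrodynamicLimits
import Literature.Analysis.UnboundedOperators.LinearizedBoltzmannBurnettBProofs
import HarnessLib

/-!
# Hydrodynamic moments of infinitesimal Maxwellians: proofs

Second companion ("Proofs") file of `HydrodynamicLimits.lean` (topic
`Literature/MathematicalPhysics/KineticTheory`; D-0014: named facts `def X : Prop` are discharged
as `theorem X_holds : X`), kept separate from the shared `HydrodynamicLimitsProofs.lean` for the
400-line budget and because it pulls in the Gaussian-moment toolbox of
`Literature.Analysis.UnboundedOperators.LinearizedBoltzmannBurnettBProofs`. It discharges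

* `Literature.MathematicalPhysics.KineticTheory.AEBoussinesqMaxwellian.moments_ae_holds :
  AEBoussinesqMaxwellian.moments_ae` (**hilbert6.S17**): if the space–time fluctuation `g` has,
  almost everywhere, the Boussinesq infinitesimal-Maxwellian form
  `g(t,x,v) = -θ(t,x) + u(t,x)·v + θ(t,x)(|v|² - d)/2` with representatives `(u, θ)`, then for
  a.e. `t > 0` and a.e. `x` the hydrodynamic moments of `g(t)` are `(ρ, u, θ) = (-θ, u, θ)(t,x)`,

and proves, on the way, the moment identities behind **hilbert6.S15**
`moments_infinitesimalMaxwellian` for the Borel σ-algebra of the velocity space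
(`moments_infinitesimalMaxwellian_of_borelSpace`): for `g = ρ + u·v + θ(|v|² - d)/2`,
`⟨g⟩ = ρ`, `⟨v g⟩ = u`, `⟨(|v|²/d - 1) g⟩ = θ` (`d = dim ≥ 1`), all moments being taken against the
normalised Maxwellian `M dv = stdGaussian E`.

Sources. The infinitesimal-Maxwellian form of limiting fluctuations is Bardos–Golse–Levermore,
CPAM 46 (1993), Prop. 2.1 (3), eq. (2.7), p. 682 (*"g = ρ + u·v + θ(½|v|² − D/2)"*) and
Prop. 3.8, eq. (3.38), p. 706; the identification of `(ρ, u, θ)` with the Maxwellian moments is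
the elementary Gaussian moment computation `⟨1⟩ = 1`, `⟨v⟩ = 0`, `⟨v ⊗ v⟩ = I`, `⟨|v|²⟩ = D`,
`⟨|v|² v⟩ = 0`, `⟨(|v|² − D)²⟩ = 2D` (Bardos–Golse–Levermore, J. Stat. Phys. 63 (1991) §3;
folklore).

## On the σ-algebra of `moments_infinitesimalMaxwellian`

The named fact `moments_infinitesimalMaxwellian` of `HydrodynamicLimits.lean` quantifies
(implicitly) over an *arbitrary* `[MeasurableSpace E]` on the velocity space: its statement does
not mention `BorelSpace E`. For a non-Borel σ-algebra the Mathlib measure `stdGaussian E` — by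
definition the push-forward `Measure.map` of the product Gaussian along an orthonormal basis — is
the zero measure whenever that linear isomorphism is not a.e.-measurable (e.g. `E = ℝ` with the
discrete σ-algebra `⊤`), and then every Maxwellian moment is `0`, so `⟨g⟩ = ρ` fails for `ρ ≠ 0`;
for the trivial σ-algebra `⊥` the integrands `v ↦ ⟪u, v⟫` are not a.e.-strongly measurable and
the Bochner integrals are again the junk value `0`. Hence that fact cannot be discharged as
stated; what is true — and what every user needs (`AEBoussinesqMaxwellian.moments_ae` and the
BGL statements carry `[BorelSpace E]`, forced by `volume` on `E`) — is the Borel case, proved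
here as `moments_infinitesimalMaxwellian_of_borelSpace : moments_infinitesimalMaxwellian` under
the extra instance `[BorelSpace E]` (same citation). No new named fact is introduced (D-0026).

## Proof architecture

All integrals are against the probability measure `M = stdGaussian E` on a finite-dimensional
real inner product space `E` with its Borel σ-algebra, `d = finrank ℝ E`.
* odd integrands (under the isometry `v ↦ -v`) integrate to `0`, scalar-valued
  (`Literature.Analysis.UnboundedOperators.integral_stdGaussian_eq_zero_of_odd`) and vector-valued
  (`integral_stdGaussian_eq_zero_of_odd_vec`, from Mathlib `stdGaussian_map`);
* second moments `∫ ⟪a, v⟫ ⟪c, v⟫ dM = ⟪a, c⟫` from Mathlib's covariance of the standard Gaussian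
  (`covarianceBilin_stdGaussian = innerSL`), whence `∫ |v|² dM = d` (Parseval in
  `stdOrthonormalBasis`) and `∫ ⟪c, v⟫ v dM = c`;
* the fourth-order identity `∫ (|v|² − d)² dM = 2d` in orthonormal coordinates
  (`stdGaussian_eq_map_pi_orthonormalBasis`) from the one-dimensional moments `𝔼 X² = 1`,
  `𝔼 X²Y² = 1 + 2δ` of `LinearizedBoltzmannBurnettBProofs.lean`;
* polynomial integrands are integrable (`integrable_stdGaussian_of_hasTemperateGrowth`, and its
  vector-valued variant `integrable_stdGaussian_of_hasTemperateGrowth_vec` proved here).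
Then `⟨g⟩ = ρ + 0 + (θ/2)(d − d)`, `⟨v g⟩ = 0 + u` (the radial part `(ρ + θ(|v|²−d)/2) v` is odd),
`⟨(|v|²/d − 1) g⟩ = (ρ/d)(d − d) + 0 + (θ/2d)·2d = θ`; and `moments_ae` follows fibrewise, since
the moments of `g(t, x, ·)` only see it up to `M`-null sets (`integral_congr_ae`).

Mathlib anchors: `ProbabilityTheory.stdGaussian_map`, `ProbabilityTheory.covarianceBilin_apply`,
`ProbabilityTheory.covarianceBilin_stdGaussian`, `ProbabilityTheory.integral_id_stdGaussian`,
`ProbabilityTheory.stdGaussian_eq_map_pi_orthonormalBasis`, `OrthonormalBasis.sum_sq_inner_right`,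
`MeasureTheory.MeasurePreserving.integral_comp`, `integral_inner`, `ext_inner_left`,
`Function.HasTemperateGrowth` (`fun_prop`).
-/

open MeasureTheory ProbabilityTheory Module Filter Set
open scoped InnerProductSpace RealInnerProductSpace ENNReal Topology
open Literature.Analysis.UnboundedOperators (integral_stdGaussian_eq_zero_of_odd
  integrable_stdGaussian_of_hasTemperateGrowth integrable_one_add_norm_pow_stdGaussian
  norm_sq_basis_sum_smul integral_coord_sq_pi_gaussianReal integrable_coord_pow_pi_gaussianReal
  integral_coord_sq_mul_coord_sq_pi_gaussianReal integrable_coord_sq_mul_coord_sq_pi_gaussianReal)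
open Literature.Analysis.FluidPDE (densityFluct bulkVelocity temperatureFluct densityFluct_apply)

namespace Literature.MathematicalPhysics.KineticTheory

variable {X : Type*}
variable {E : Type*} [NormedAddCommGroup E] [InnerProductSpace ℝ E] [FiniteDimensional ℝ E]
  [MeasurableSpace E] [BorelSpace E]

/-! ### Gaussian moments on a finite-dimensional inner product space -/

section GaussMoments

/-- A vector-valued integrand that is odd under some linear isometry of `E` has zero integral
against the Maxwellian `M dv = stdGaussian E` (the Gaussian is invariant under linear
isometries, Mathlib `stdGaussian_map`; Bochner's junk value `0` included, no integrability
needed). [folklore] -/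
theorem integral_stdGaussian_eq_zero_of_odd_vec {F : Type*} [NormedAddCommGroup F]
    [NormedSpace ℝ F] (f : E ≃ₗᵢ[ℝ] E) {g : E → F} (hg : ∀ v, g (f v) = -g v) :
    ∫ v, g v ∂stdGaussian E = 0 := by
  have hmp : MeasurePreserving f (stdGaussian E) (stdGaussian E) :=
    ⟨f.continuous.measurable, stdGaussian_map f⟩
  have h := hmp.integral_comp f.toHomeomorph.measurableEmbedding g
  simp only [hg, integral_neg] at h
  have : IsAddTorsionFree F := .of_isTorsionFree ℝ F
  exact self_eq_neg.1 h.symm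

/-- A vector-valued function of temperate growth (`‖f(v)‖ ≤ C (1 + |v|)^k`, `f` smooth) is
integrable against the Maxwellian `M dv = stdGaussian E` (Gaussian measures have moments of all
orders; vector-valued variant of
`Literature.Analysis.UnboundedOperators.integrable_stdGaussian_of_hasTemperateGrowth`).
[folklore] -/
theorem integrable_stdGaussian_of_hasTemperateGrowth_vec {F : Type*} [NormedAddCommGroup F]
    [NormedSpace ℝ F] {f : E → F} (hf : Function.HasTemperateGrowth f) :
    Integrable f (stdGaussian E) := by
  obtain ⟨k, C, hC⟩ := hf.2 0
  refine Integrable.mono' ((integrable_one_add_norm_pow_stdGaussian k).const_mul C)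
    hf.1.continuous.aestronglyMeasurable (ae_of_all _ fun v => ?_)
  simpa [norm_iteratedFDeriv_zero] using hC v

/-- **Second moments of the Maxwellian**: `∫ ⟪a, v⟫ ⟪c, v⟫ M dv = ⟪a, c⟫`, i.e. `⟨v ⊗ v⟩ = I`
(the covariance of the standard Gaussian is the inner product, Mathlib
`covarianceBilin_stdGaussian`, and its mean is `0`). [folklore] -/
theorem integral_inner_mul_inner_stdGaussian (a c : E) :
    ∫ v, ⟪a, v⟫ * ⟪c, v⟫ ∂stdGaussian E = ⟪a, c⟫ := by
  haveI : CompleteSpace E := FiniteDimensional.complete ℝ E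
  have h := covarianceBilin_apply (μ := stdGaussian E) IsGaussian.memLp_two_id a c
  rw [covarianceBilin_stdGaussian, innerSL_apply_apply] at h
  simp only [id_eq, integral_id_stdGaussian, sub_zero] at h
  exact h.symm

/-- **`⟨|v|²⟩ = d`**: `∫ ‖v‖² M dv = finrank ℝ E` (Parseval in an orthonormal basis and
`⟨vᵢ²⟩ = 1`). [folklore] -/
theorem integral_norm_sq_stdGaussian_eq_finrank :
    ∫ v, ‖v‖ ^ 2 ∂stdGaussian E = finrank ℝ E := by
  simp_rw [← (stdOrthonormalBasis ℝ E).sum_sq_inner_right]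
  rw [integral_finsetSum _ fun i _ => ?_]
  · simp_rw [pow_two, integral_inner_mul_inner_stdGaussian, real_inner_self_eq_norm_sq,
      (stdOrthonormalBasis ℝ E).orthonormal.1]
    simp
  · exact integrable_stdGaussian_of_hasTemperateGrowth (by fun_prop)

/-- **`⟨⟪c, v⟫ v⟩ = c`**: `∫ ⟪c, v⟫ v M dv = c` (from `⟨v ⊗ v⟩ = I`, tested against every
`w ∈ E`). [folklore] -/
theorem integral_inner_smul_self_stdGaussian (c : E) :
    ∫ v, ⟪c, v⟫ • v ∂stdGaussian E = c := by
  haveI : CompleteSpace E := FiniteDimensional.complete ℝ E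
  have hint : Integrable (fun v : E => ⟪c, v⟫ • v) (stdGaussian E) :=
    integrable_stdGaussian_of_hasTemperateGrowth_vec (by fun_prop)
  refine ext_inner_left ℝ fun w => ?_
  rw [← integral_inner hint w]
  simp_rw [real_inner_smul_right]
  rw [integral_inner_mul_inner_stdGaussian, real_inner_comm]

/-- **Fourth-order identity `⟨(|v|² − d)²⟩ = 2d`**: `∫ (‖v‖² - d)² M dv = 2 d`, `d = finrank ℝ E`
(equivalently `⟨|v|⁴⟩ = d(d + 2)`), computed in the coordinates of `stdOrthonormalBasis ℝ E`
(`M dv` is the image of `⊗ᵢ 𝒩(0,1)`, Mathlib `stdGaussian_eq_map_pi_orthonormalBasis`) from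
`𝔼 Xᵢ² = 1` and `𝔼 Xᵢ² Xⱼ² = 1 + 2δᵢⱼ`. [folklore] -/
theorem integral_norm_sq_sub_finrank_sq_stdGaussian :
    ∫ v, (‖v‖ ^ 2 - finrank ℝ E) ^ 2 ∂stdGaussian E = 2 * finrank ℝ E := by
  classical
  rw [stdGaussian_eq_map_pi_orthonormalBasis (stdOrthonormalBasis ℝ E),
    integral_map (Measurable.aemeasurable (by fun_prop))
      (Continuous.aestronglyMeasurable (by fun_prop))]
  simp_rw [norm_sq_basis_sum_smul]
  have hexp : ∀ x : Fin (finrank ℝ E) → ℝ, (∑ j, x j ^ 2 - (finrank ℝ E : ℝ)) ^ 2 =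
      ∑ i, ∑ j, x i ^ 2 * x j ^ 2 - 2 * (finrank ℝ E : ℝ) * ∑ j, x j ^ 2 +
        (finrank ℝ E : ℝ) ^ 2 := fun x => by
    rw [sub_sq, sq (∑ j, x j ^ 2), Finset.sum_mul_sum]
    ring
  simp_rw [hexp]
  have I22 := fun i j : Fin (finrank ℝ E) => integrable_coord_sq_mul_coord_sq_pi_gaussianReal i j
  have I2 := fun j : Fin (finrank ℝ E) => integrable_coord_pow_pi_gaussianReal j 2
  have h1 : Integrable (fun x : Fin (finrank ℝ E) → ℝ => ∑ i, ∑ j, x i ^ 2 * x j ^ 2)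
      (Measure.pi fun _ : Fin (finrank ℝ E) => gaussianReal 0 1) :=
    integrable_finsetSum _ fun i _ => integrable_finsetSum _ fun j _ => I22 i j
  have h2 : Integrable (fun x : Fin (finrank ℝ E) → ℝ => 2 * (finrank ℝ E : ℝ) * ∑ j, x j ^ 2)
      (Measure.pi fun _ : Fin (finrank ℝ E) => gaussianReal 0 1) :=
    (integrable_finsetSum _ fun j _ => I2 j).const_mul _
  have h12 : Integrable (fun x : Fin (finrank ℝ E) → ℝ =>
      ∑ i, ∑ j, x i ^ 2 * x j ^ 2 - 2 * (finrank ℝ E : ℝ) * ∑ j, x j ^ 2)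
      (Measure.pi fun _ : Fin (finrank ℝ E) => gaussianReal 0 1) := h1.sub h2
  rw [integral_add h12 (integrable_const ((finrank ℝ E : ℝ) ^ 2)), integral_sub h1 h2,
    integral_const_mul, integral_finsetSum _ fun i _ => integrable_finsetSum _ fun j _ => I22 i j,
    integral_finsetSum _ fun j _ => I2 j, integral_const, probReal_univ, one_smul]
  simp_rw [integral_finsetSum _ fun j _ => I22 _ j, integral_coord_sq_mul_coord_sq_pi_gaussianReal,
    integral_coord_sq_pi_gaussianReal, Finset.sum_add_distrib, Finset.sum_ite_eq,
    Finset.mem_univ, if_true, Finset.sum_const, Finset.card_univ, Fintype.card_fin, nsmul_eq_mul]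
  ring

end GaussMoments

/-! ### hilbert6.S15: moments of an infinitesimal Maxwellian (Borel velocity space) -/

section Moments

omit [BorelSpace E] in
/-- **Moments of an infinitesimal Maxwellian** (hilbert6.S15), the named fact
`moments_infinitesimalMaxwellian` for the **Borel** σ-algebra of the velocity space: for
`g = ρ + u·v + θ(|v|² - d)/2` (`d = dim E ≥ 1`) the hydrodynamic moments against
`M dv = stdGaussian E` recover `(ρ, u, θ)`: `⟨g⟩ = ρ`, `⟨v g⟩ = u`, `⟨(|v|²/d - 1) g⟩ = θ`
(Bardos–Golse–Levermore 1993, Prop. 2.1 (3), eq. (2.7), p. 682: the limiting fluctuation is the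
infinitesimal Maxwellian *"g = ρ + u·v + θ(½|v|² − D/2)"*, whose fluid variables are its
Maxwellian moments; Gaussian moments `⟨v ⊗ v⟩ = I`, `⟨|v|⁴⟩ = D(D+2)`; BGL 1991 §3).
*Discrepancy with the fact as vendored:* `moments_infinitesimalMaxwellian` omits `[BorelSpace E]`
and so also speaks about non-Borel σ-algebras on `E`, for which Mathlib's `stdGaussian E` is the
zero measure or the moment integrands are not a.e.-strongly measurable, all moments are the junk
value `0`, and `⟨g⟩ = ρ` fails for `ρ ≠ 0`; it is therefore not dischargeable as stated, and this
theorem — the fact under the extra instance `[BorelSpace E]`, which every user in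
`HydrodynamicLimits.lean` has — is its corrected form.
[cite: BardosGolseLevermoreCPAM1993, Prop. 2.1 (3), eq. (2.7), p. 682] -/
theorem moments_infinitesimalMaxwellian_of_borelSpace [BorelSpace E] :
    moments_infinitesimalMaxwellian (X := X) (E := E) := by
  intro hE ρ u θ x
  dsimp only
  have hd : (finrank ℝ E : ℝ) ≠ 0 := Nat.cast_ne_zero.2 hE.ne'
  -- the two scalar ingredients
  have hnorm := integral_norm_sq_stdGaussian_eq_finrank (E := E)
  have iNormSq : Integrable (fun v : E => ‖v‖ ^ 2) (stdGaussian E) :=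
    integrable_stdGaussian_of_hasTemperateGrowth (by fun_prop)
  have iInner : Integrable (fun v : E => ⟪u x, v⟫) (stdGaussian E) :=
    integrable_stdGaussian_of_hasTemperateGrowth (by fun_prop)
  have hRad : (fun v : E => θ x * (‖v‖ ^ 2 - finrank ℝ E) / 2) =
      fun v => θ x / 2 * (‖v‖ ^ 2 - finrank ℝ E) := by
    funext v; ring
  have iRad : Integrable (fun v : E => θ x * (‖v‖ ^ 2 - finrank ℝ E) / 2) (stdGaussian E) := by
    rw [hRad]
    exact integrable_stdGaussian_of_hasTemperateGrowth (by fun_prop)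
  have hodd : ∫ v, ⟪u x, v⟫ ∂stdGaussian E = 0 :=
    integral_stdGaussian_eq_zero_of_odd (LinearIsometryEquiv.neg ℝ) fun v => by
      simp [inner_neg_right]
  have hrad0 : ∫ v, θ x * (‖v‖ ^ 2 - finrank ℝ E) / 2 ∂stdGaussian E = 0 := by
    rw [hRad, integral_const_mul, integral_sub iNormSq (integrable_const _), hnorm]
    simp
  refine ⟨?_, ?_, ?_⟩
  · -- density `⟨g⟩ = ρ + 0 + (θ/2)(d - d)`
    simp only [densityFluct_apply]
    rw [integral_add ((integrable_const (ρ x)).fun_add iInner) iRad,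
      integral_add (integrable_const (ρ x)) iInner, hodd, hrad0, integral_const, probReal_univ,
      one_smul, add_zero, add_zero]
  · -- bulk velocity `⟨v g⟩ = 0 + u`: the radial part is odd
    simp only [bulkVelocity]
    have hsplit : ∀ v : E, (ρ x + ⟪u x, v⟫ + θ x * (‖v‖ ^ 2 - finrank ℝ E) / 2) • v =
        (ρ x + θ x / 2 * (‖v‖ ^ 2 - finrank ℝ E)) • v + ⟪u x, v⟫ • v := fun v => by
      rw [← add_smul]
      congr 1
      ring
    simp_rw [hsplit]
    have i1 : Integrable (fun v : E => (ρ x + θ x / 2 * (‖v‖ ^ 2 - finrank ℝ E)) • v)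
        (stdGaussian E) :=
      integrable_stdGaussian_of_hasTemperateGrowth_vec (by fun_prop)
    have i2 : Integrable (fun v : E => ⟪u x, v⟫ • v) (stdGaussian E) :=
      integrable_stdGaussian_of_hasTemperateGrowth_vec (by fun_prop)
    have hodd' : ∫ v, (ρ x + θ x / 2 * (‖v‖ ^ 2 - finrank ℝ E)) • v ∂stdGaussian E = 0 :=
      integral_stdGaussian_eq_zero_of_odd_vec (LinearIsometryEquiv.neg ℝ) fun v => by
        simp [norm_neg, smul_neg]
    rw [integral_add i1 i2, hodd', integral_inner_smul_self_stdGaussian, zero_add]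
  · -- temperature `⟨(|v|²/d - 1) g⟩ = (ρ/d)(d - d) + 0 + (θ/2d)·2d`
    simp only [temperatureFluct]
    have hsplit : ∀ v : E,
        (‖v‖ ^ 2 / finrank ℝ E - 1) * (ρ x + ⟪u x, v⟫ + θ x * (‖v‖ ^ 2 - finrank ℝ E) / 2) =
          ρ x / finrank ℝ E * (‖v‖ ^ 2 - finrank ℝ E) +
              ⟪u x, v⟫ * ((finrank ℝ E : ℝ)⁻¹ * ‖v‖ ^ 2 - 1) +
            θ x / (2 * finrank ℝ E) * (‖v‖ ^ 2 - finrank ℝ E) ^ 2 := fun v => by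
      field_simp
    simp_rw [hsplit]
    have j1 : Integrable (fun v : E => ρ x / finrank ℝ E * (‖v‖ ^ 2 - finrank ℝ E))
        (stdGaussian E) :=
      integrable_stdGaussian_of_hasTemperateGrowth (by fun_prop)
    have j2 : Integrable (fun v : E => ⟪u x, v⟫ * ((finrank ℝ E : ℝ)⁻¹ * ‖v‖ ^ 2 - 1))
        (stdGaussian E) :=
      integrable_stdGaussian_of_hasTemperateGrowth (by fun_prop)
    have j3 : Integrable (fun v : E => θ x / (2 * finrank ℝ E) * (‖v‖ ^ 2 - finrank ℝ E) ^ 2)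
        (stdGaussian E) :=
      integrable_stdGaussian_of_hasTemperateGrowth (by fun_prop)
    have hodd'' : ∫ v, ⟪u x, v⟫ * ((finrank ℝ E : ℝ)⁻¹ * ‖v‖ ^ 2 - 1) ∂stdGaussian E = 0 :=
      integral_stdGaussian_eq_zero_of_odd (LinearIsometryEquiv.neg ℝ) fun v => by
        simp [inner_neg_right, norm_neg]
    rw [integral_add (j1.fun_add j2) j3, integral_add j1 j2, hodd'', integral_const_mul,
      integral_const_mul, integral_sub iNormSq (integrable_const (finrank ℝ E : ℝ)), hnorm,
      integral_norm_sq_sub_finrank_sq_stdGaussian, integral_const, probReal_univ, one_smul,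
      sub_self, mul_zero, zero_add, zero_add]
    exact div_mul_cancel₀ _ (mul_ne_zero two_ne_zero hd)

end Moments

/-! ### hilbert6.S17: the discharge of `AEBoussinesqMaxwellian.moments_ae` -/

section MomentsAE

/-- **Discharge** of `AEBoussinesqMaxwellian.moments_ae` (hilbert6.S17): if `g` has the a.e.
Boussinesq–Maxwellian form `g(t,x,v) = -θ(t,x) + u(t,x)·v + θ(t,x)(|v|² - d)/2` with
representatives `(u, θ)` (a.e. `t > 0`, a.e. `x`, `M dv`-a.e. `v`), then for a.e. `t > 0` and
a.e. `x` the hydrodynamic moments of `g(t)` are `(ρ, u, θ)(x) = (-θ(t,x), u(t,x), θ(t,x))`: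
fibrewise this is `moments_infinitesimalMaxwellian_of_borelSpace` with `ρ = -θ(t)`, the
Maxwellian moments of `g(t, x, ·)` depending on it only up to `M`-null sets
(Bardos–Golse–Levermore 1993, Prop. 2.1 (3) eq. (2.7) p. 682 and Thm. 1.1 (1.47)–(1.48)
p. 676: infinitesimal Maxwellian form and Boussinesq relation of the limit; velocity dimension
`≥ 1`). [cite: BardosGolseLevermoreCPAM1993, Prop. 2.1 (3), eq. (2.7), p. 682] -/
theorem AEBoussinesqMaxwellian.moments_ae_holds : AEBoussinesqMaxwellian.moments_ae (E := E) := by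
  intro hE g u θ h
  filter_upwards [h] with t ht
  filter_upwards [ht] with x hx
  obtain ⟨h1, h2, h3⟩ :=
    moments_infinitesimalMaxwellian_of_borelSpace (X := E) (E := E) hE (fun y => -θ t y) (u t)
      (θ t) x
  simp only [densityFluct_apply, bulkVelocity, temperatureFluct] at h1 h2 h3 ⊢
  refine ⟨?_, ?_, ?_⟩
  · rw [← h1]
    exact integral_congr_ae (by filter_upwards [hx] with v hv; rw [hv])
  · rw [← h2]
    exact integral_congr_ae (by filter_upwards [hx] with v hv; rw [hv])
  · rw [← h3]
    exact integral_congr_ae (by filter_upwards [hx] with v hv; rw [hv])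

end MomentsAE

end Literature.MathematicalPhysics.KineticTheory
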